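import Summits.QuantumFields.BalabanUV.Beta.GAN24.SpureRecSlotChargeThreeFace

/-!
# `BalabanUV.Beta.GAN24.SpureRecLegChargeThreeFace` — binder row G-an2-4 ∕ (CONV-C), W-slot CT-W, route «WC-TL», the table fact «S3C-REC» (PART 2 of leaf-04 g62's
# INTENT I-leaf04-g62-1 «S3C-STEP ∕ THREE-FACE»; PART 1 = `SpureRecSlotChargeThreeFace`):
# **CLAUSES (ii) ∕ (iii) OF «S3C-REC» MEMBER `j+1` HAVE THE VALUE OF CLAUSE (i) — the ff block of member `j+1` is covariant under EVERY translation of its own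
# lattice, so the (slot, one leg) sums are RE-INDEXINGS of the (two legs) sum; hence «3F-REC ⟹ S3C-REC» (every member) and road FP's D1 literal MODULO
# «3F-REC» ∧ (C) ∧ (Q-D) ∧ (Q-D-rate)**

NOT IN PRINT; OUR BOOKKEEPING ([folklore]; G-an2-4 formalisation swarm, leaf prover `b2b-balaban-gan24-formalise-leaf-04`, gen 62; names PROVISIONAL — the OWNER gan24-p1 may
rename ∕ re-cut).  HONEST FRAMING (cell contract, verbatim): «discharging `BetaPertH` makes Bałaban's UV stability UNCONDITIONAL — a real constructive-QFT result; it is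
NOT the continuum limit and NOT the Clay problem.»  HONEST DEPENDENCY (verbatim): «continuum YM on T⁴ ⇐ BetaPertH ∧ nine spine estimates (0/9 proved); BetaPertH ⇐ (D1) ∧
(D4) ∧ CAP+tail; G-an2-4 gates asym, D1 and NE2/3/4.»

WHY.  PART 1 computed clause (i) of «S3C-REC» member `j+1` (slot fixed, both field legs summed) in closed form: `U·(cE·wE (j+1))·(Lc·σ_j)³·3F_j(κ″; α, β)`, the
THREE-FACE-LEGS CELL FORM of the folded member `j`, independent of the slot.  Clauses (ii) ∕ (iii) (slot AND one leg summed, the other leg FIXED at `s`) need no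
second Fubini: the ff block of member `j+1` is `−U·(cE·wE)·mmRead Lc (G_j ∘ vertexOfK G_j Lc (SrecAt … j) κ″ u ∘ G_j)` (the rooted border `vhSAt` — only
block-covariant — is OFF the ff block), and an2's `e3OfK_translate` (over `shiftK_coDressKBmAt_KInvStep` and `SrecAt_translate`) makes it covariant under EVERY
translation `t` of the level-`(j+1)` lattice: `S_{j+1}(κ″, u)(x, z)_{ff} = S_{j+1}(κ″, 0)(x − u, z − u)_{ff}`.  So `(u, x) ↦ (x − u, s − u)` (resp. `(u, z) ↦ (s − u, z − u)`),
a bijection of `ℤ^{d+1} × ℤ^{d+1}`, carries the (slot, leg) family onto the (leg, leg) family at slot `0` TERM BY TERM (`Equiv.hasSum_iff`): all three clauses of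
member `j+1` have the same value, and «S3C-REC» member `j+1` ⟸ `3F_j(κ″; α, β) = 0`.  With member `0` (leaf-19's `wilsonA` laws, `SourceBracketCombOfS3c` §5):
«S3C-REC» ⟸ «3F-REC» := `∀ j γ α β, 3F_j(γ; α, β) = 0` — ONE cell identity per level about the folded table with its slot and both field legs on block exit
faces — and leaf-01's CAPSTONE reads: road FP's D1 literal ⟸ {«3F-REC», (C)sym, (Q-D), (Q-D-rate)}.

WHAT ([folklore]; 0 `def`, 0 cited facts, 0 `def … : Prop`, 0 sorry):
* §4 `unitS_SpureRecAt_succ_inl_inl_shift` (full translation covariance of the ff block of member `j+1`), **`hasSum_slot_leg_unitS_SpureRecAt_succ`** (clause (ii) with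
  values), **`hasSum_slot_leg'_unitS_SpureRecAt_succ`** (clause (iii) with values) — both equal to PART 1's clause (i) value.
* §5 **`hasSum_unitS_SpureRecAt_of_threeFace`** («3F-REC» ⟹ the hypothesis `h3` of `SourceBracketCombOfS3c` at every level, all units, any in-block root, generic `d`),
  **`exists_allScalesSeq_JsRowD1Pin_of_threeFace_C_QD`** (leaf-01 g63's capstone ∕ this lineage's g61 re-cut with «S3C-REC» REPLACED by «3F-REC»).
ENGINE (DIAG-ONLY, PART 1's header): `3F_j = 0` to rounding at j = 0, 1, 2 (D = 2, n = 3, four geometries); decides nothing in the kernel.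
NOT HERE: `3F_0 = 0` (two finite face laws — the cubic Wilson table's three-exit-face cell law and an1's `hessFFAt` two-face law ∕ the multiplier clause), the
induction `3F_j ⟹ 3F_{j+1}` (design level: a three-CLOSED-legs law + «closed background ⟹ closed response, zero multiplier» for the comb kernel).  Asserts NO value
of Bałaban's tables; discharges NOTHING of «3F-REC» ∕ «S3C-REC» (members ≥ 1) ∕ F2a-comb ∕ (C)sym ∕ (Q-D) ∕ (Q-D-rate) ∕ «T2Shape» ∕ «T2Drift» ∕ (hW, hWall)
unconditionally; NOT «D1 closed»; NEVER «G-an2-4 closed» as (CONV-C); NOT D1, NOT `BetaPertH`, NOT continuum, NOT Clay.  2026-08-22; no existing file touched.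
-/

noncomputable section

open Finset
open scoped BigOperators
open Literature.MathematicalPhysics.QuantumFieldTheory
open Literature.MathematicalPhysics.QuantumFieldTheory.Balaban1983to89
open Literature.MathematicalPhysics.QuantumFieldTheory.Balaban1983to89.Beta
open B12Sec2to5 (l1)
open ExpKernelCalculus (Site MKer BiLoc Decays VertexFamily comp shiftK)
open AffineAveraging (box toSite)
open OneStepResolventKernel (Fib LocStencil wsum)
open OneStepKernelFamily (KInvStep colH vertexOfK abs_colH_le vertexFamily_vertexOfK' decays_KInvStep)
open BalabanStepJetsSucc (mmRead mmRead_inl_inl wE wVH)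
open AveragingHessianKernels (packVH_inl_inl)
open Summit.QuantumFields.BalabanUV.Beta.HessKerDressedUnits (unitS unitS_apply)
open Summit.QuantumFields.BalabanUV.Beta.AxialDressingRooted (coDressKBmAt decays_coDressKBmAt_KInvStep shiftK_coDressKBmAt_KInvStep)
open Summit.QuantumFields.BalabanUV.Beta.WardLocusRecursive (SrecAt locStencil_SrecAt SrecAt_translate)
open Summit.QuantumFields.BalabanUV.Beta.SpineRooted (SpureRecAt e3OfK e3OfK_apply e3OfK_translate SpureRecAt_succ)
open Summit.QuantumFields.BalabanUV.Beta.GAN24.BiStencilZeroMode (tsum_mul_periodic)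
open Summit.QuantumFields.BalabanUV.Beta.GAN24.SandwichReadoutSiteDep (hasSum_sandwich_readout_coDressKBmAt hasSum_coDressKBmAt_col)
open Summit.QuantumFields.BalabanUV.Beta.GAN24.StepResolventLegCharges (hasSum_KInvStep_inr_inl hasSum_KInvStep_inl_inr)
open Summit.QuantumFields.BalabanUV.Beta.GAN24.MultiplierZeroMass (hasSum_KInvStep_mm_left hasSum_KInvStep_mm_right)
open Summit.QuantumFields.BalabanUV.Beta.GAN24.WilsonVertexTwoConst (unitS_inl_inl)
open Summit.QuantumFields.BalabanUV.Beta.SecondOrderUnits (unitS₂)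
open Summit.QuantumFields.BalabanUV.Beta.SpineRooted (T2RecOf T2RecAt M1At)
open Summit.QuantumFields.BalabanUV.Beta.GAN24.CombesThomas (sfStep smStep)
open Summit.QuantumFields.BalabanUV.Beta.GAN24.BiStencilZeroMode (Tab zmode)
open AveragingMixedJetTables (mixFFAt)
open BalabanCompositeJets (LocStencil₂)
open RemainderConstAllScales (AllScalesSeq)
open OneStepKernelFamily (TbalOf)
open AveragingContoursRooted (ctrOff ctrOff_mem_box)
open WilsonVertex2Sym (wsym22)
open Summit.QuantumFields.BalabanUV.Beta.AxialDressingRooted (dressKBmAt coProjBmAtK)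
open Summit.QuantumFields.BalabanUV.Beta.SecondOrderSocketIdentification (vh₂SAn1)
open Summit.QuantumFields.BalabanUV.Beta.RowD1JointEnd (JsRowD1Pin)
open Summit.QuantumFields.BalabanUV.Beta.GAN24.WardResidualRotatedVertexWeighted (hasSum_weighted_vertexOfK)

namespace Summit.QuantumFields.BalabanUV.Beta.GAN24.SpureRecLegChargeThreeFace

open Summit.QuantumFields.BalabanUV.Beta.GAN24.SpureRecSlotChargeThreeFace (hasSum_legs_unitS_SpureRecAt_succ)

variable {d : ℕ}

/-! ## §4 Clauses (ii) ∕ (iii) of member `j+1` FROM clause (i): the ff block of member `j+1` is translation covariant on its own lattice -/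

section LegCharges

variable {Lc : ℕ} [NeZero Lc]

/-- [folklore] **THE ff BLOCK OF THE NORMALISED MEMBER `j+1` IS COVARIANT UNDER EVERY TRANSLATION OF ITS OWN LATTICE** (not only block
translations): `unitS (SpureRecAt … (j+1)) κ″ u x z (inl α) (inl β) = unitS (SpureRecAt … (j+1)) κ″ 0 (x − u) (z − u) (inl α) (inl β)` — the cubic sector
`e3OfK Lc G_j (SrecAt … j)` is covariant under all coarse translations (`e3OfK_translate` over `shiftK_coDressKBmAt_KInvStep` and `SrecAt_translate`), and the
rooted border `vhSAt` (only block-covariant) is OFF the ff block. -/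
theorem unitS_SpureRecAt_succ_inl_inl_shift (hLc : 1 ≤ Lc) (r : Fin (d + 1) → ℕ) (sf sm cE cVH cΛ : ℝ) (j : ℕ) (κ'' : Fin (d + 1))
    (u x z : Site (d + 1)) (α β : Fin (d + 1)) :
    unitS sf sm (SpureRecAt d Lc (toSite r) cE cVH cΛ (j + 1)) κ'' u x z (Sum.inl α) (Sum.inl β)
      = unitS sf sm (SpureRecAt d Lc (toSite r) cE cVH cΛ (j + 1)) κ'' 0 (x - u) (z - u) (Sum.inl α) (Sum.inl β) := by
  have hGs : ∀ t : Site (d + 1), shiftK (-((Lc : ℤ) • t)) (coDressKBmAt (toSite r) Lc (KInvStep (d := d) Lc j))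
      = coDressKBmAt (toSite r) Lc (KInvStep (d := d) Lc j) := fun t => shiftK_coDressKBmAt_KInvStep (d := d) (toSite r) j t
  have hSt : ∀ (κ : Fin (d + 1)) (u t : Site (d + 1)), SrecAt d Lc (toSite r) cE cVH cΛ j κ (u + (Lc : ℤ) • t)
      = shiftK (-((Lc : ℤ) • t)) (SrecAt d Lc (toSite r) cE cVH cΛ j κ u) := fun κ u t => SrecAt_translate (toSite r) hLc cE cVH cΛ j κ u t
  have h := e3OfK_translate (N := Lc) hGs hSt κ'' 0 u
  rw [zero_add] at h
  rw [unitS_inl_inl, unitS_inl_inl, SpureRecAt_succ]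
  simp only [Pi.add_apply, Pi.smul_apply, smul_eq_mul, AveragingHessianKernelsRooted.vhSAt, packVH_inl_inl, mul_zero, add_zero]
  rw [h]
  simp only [shiftK, sub_eq_add_neg]

/-- NOT IN PRINT; OUR BOOKKEEPING.  **CLAUSE (ii) OF «S3C-REC» MEMBER `j+1`, WITH VALUES** — the slot site AND the first field leg summed, the second
leg fixed at `s`: the SAME value as clause (i) (the three-face-legs cell form of the folded member `j`), for every `s` — by translation covariance of the ff
block and the re-indexing `(u, x) ↦ (x − u, s − u)` of `ℤ^{d+1} × ℤ^{d+1}` (`Equiv.hasSum_iff`; no Fubini). -/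
theorem hasSum_slot_leg_unitS_SpureRecAt_succ (hLc : 1 ≤ Lc) {r : Fin (d + 1) → ℕ} (hr : r ∈ box (d + 1) Lc) (sf sm cE cVH cΛ : ℝ) (j : ℕ)
    (κ'' : Fin (d + 1)) (α β : Fin (d + 1)) (s : Site (d + 1)) :
    HasSum (fun p : Site (d + 1) × Site (d + 1) =>
        unitS sf sm (SpureRecAt d Lc (toSite r) cE cVH cΛ (j + 1)) κ'' p.1 p.2 s (Sum.inl α) (Sum.inl β))
      ((sf * sm)⁻¹ * (sf⁻¹ * sf⁻¹) * (cE * wE d Lc (j + 1)) * ((Lc : ℝ) * ((((Lc ^ (j + 1) : ℕ) : ℝ)) ^ (d + 1 + 1))⁻¹) ^ 3 *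
        ∑ v ∈ box (d + 1) Lc, (if toSite v κ'' % (Lc : ℤ) = (Lc : ℤ) - 1 then (1 : ℝ) else 0) *
          ∑' yw : Site (d + 1) × Site (d + 1),
            (if yw.1 α % (Lc : ℤ) = (Lc : ℤ) - 1 then (1 : ℝ) else 0) * (if yw.2 β % (Lc : ℤ) = (Lc : ℤ) - 1 then (1 : ℝ) else 0) *
              SrecAt d Lc (toSite r) cE cVH cΛ j κ'' (toSite v) yw.1 yw.2 (Sum.inl α) (Sum.inl β)) := by
  have hi := hasSum_legs_unitS_SpureRecAt_succ hLc hr sf sm cE cVH cΛ j κ'' 0 α β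
  -- re-index the leg pair by `(u, x) ↦ (x − u, s − u)`
  have hfun : (fun p : Site (d + 1) × Site (d + 1) =>
        unitS sf sm (SpureRecAt d Lc (toSite r) cE cVH cΛ (j + 1)) κ'' p.1 p.2 s (Sum.inl α) (Sum.inl β))
      = (fun q : Site (d + 1) × Site (d + 1) => unitS sf sm (SpureRecAt d Lc (toSite r) cE cVH cΛ (j + 1)) κ'' 0 q.1 q.2 (Sum.inl α) (Sum.inl β))
        ∘ ⇑((Equiv.prodShear (Equiv.subLeft s) (fun u : Site (d + 1) => Equiv.subRight u)).trans
            (Equiv.prodComm (Site (d + 1)) (Site (d + 1)))) := by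
    funext p
    obtain ⟨u, x⟩ := p
    simp only [Function.comp_apply, Equiv.trans_apply, Equiv.prodShear_apply, Equiv.prodComm_apply, Prod.swap_prod_mk,
      Equiv.subLeft_apply, Equiv.subRight_apply]
    exact unitS_SpureRecAt_succ_inl_inl_shift hLc r sf sm cE cVH cΛ j κ'' u x s α β
  rw [hfun]
  exact (Equiv.hasSum_iff _).2 hi

/-- NOT IN PRINT; OUR BOOKKEEPING.  **CLAUSE (iii) OF «S3C-REC» MEMBER `j+1`, WITH VALUES** — the slot site AND the second field leg summed, the first
leg fixed at `s`: again the value of clause (i) (re-indexing `(u, z) ↦ (s − u, z − u)`). -/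
theorem hasSum_slot_leg'_unitS_SpureRecAt_succ (hLc : 1 ≤ Lc) {r : Fin (d + 1) → ℕ} (hr : r ∈ box (d + 1) Lc) (sf sm cE cVH cΛ : ℝ) (j : ℕ)
    (κ'' : Fin (d + 1)) (α β : Fin (d + 1)) (s : Site (d + 1)) :
    HasSum (fun p : Site (d + 1) × Site (d + 1) =>
        unitS sf sm (SpureRecAt d Lc (toSite r) cE cVH cΛ (j + 1)) κ'' p.1 s p.2 (Sum.inl α) (Sum.inl β))
      ((sf * sm)⁻¹ * (sf⁻¹ * sf⁻¹) * (cE * wE d Lc (j + 1)) * ((Lc : ℝ) * ((((Lc ^ (j + 1) : ℕ) : ℝ)) ^ (d + 1 + 1))⁻¹) ^ 3 *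
        ∑ v ∈ box (d + 1) Lc, (if toSite v κ'' % (Lc : ℤ) = (Lc : ℤ) - 1 then (1 : ℝ) else 0) *
          ∑' yw : Site (d + 1) × Site (d + 1),
            (if yw.1 α % (Lc : ℤ) = (Lc : ℤ) - 1 then (1 : ℝ) else 0) * (if yw.2 β % (Lc : ℤ) = (Lc : ℤ) - 1 then (1 : ℝ) else 0) *
              SrecAt d Lc (toSite r) cE cVH cΛ j κ'' (toSite v) yw.1 yw.2 (Sum.inl α) (Sum.inl β)) := by
  have hi := hasSum_legs_unitS_SpureRecAt_succ hLc hr sf sm cE cVH cΛ j κ'' 0 α β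
  -- re-index the (slot, second leg) pair by `(u, z) ↦ (s − u, z − u)`
  have hfun : (fun p : Site (d + 1) × Site (d + 1) =>
        unitS sf sm (SpureRecAt d Lc (toSite r) cE cVH cΛ (j + 1)) κ'' p.1 s p.2 (Sum.inl α) (Sum.inl β))
      = (fun q : Site (d + 1) × Site (d + 1) => unitS sf sm (SpureRecAt d Lc (toSite r) cE cVH cΛ (j + 1)) κ'' 0 q.1 q.2 (Sum.inl α) (Sum.inl β))
        ∘ ⇑(Equiv.prodShear (Equiv.subLeft s) (fun u : Site (d + 1) => Equiv.subRight u)) := by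
    funext p
    obtain ⟨u, z⟩ := p
    simp only [Function.comp_apply, Equiv.prodShear_apply, Equiv.subLeft_apply, Equiv.subRight_apply]
    exact unitS_SpureRecAt_succ_inl_inl_shift hLc r sf sm cE cVH cΛ j κ'' u s z α β
  rw [hfun]
  exact (Equiv.hasSum_iff _).2 hi

end LegCharges


/-! ## §5 «3F-REC ⟹ S3C-REC» (all members) and road FP's D1 literal modulo «3F-REC» ∧ (C) ∧ (Q-D) ∧ (Q-D-rate) -/

section Package

variable {Lc : ℕ} [NeZero Lc]

/-- NOT IN PRINT; OUR BOOKKEEPING.  **«3F-REC» ⟹ «S3C-REC», EVERY MEMBER, EVERY ROOT-IN-BLOCK, ALL UNITS.**  If at every level `j` the THREE-FACE-LEGS CELL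
FORM of the folded table vanishes — `∀ j γ α β, Σ_{v ∈ box} [v_γ % Lc = Lc−1]·Σ'_{(y,w)} [y_α % Lc = Lc−1]·[w_β % Lc = Lc−1]·SrecAt … j γ v y w (inl α) (inl β) = 0` —
then ALL THREE two-constant-leg ff contractions of `unitS s_f s_m (SpureRecAt … j)` vanish at every level (member `0`: leaf-19's `wilsonA` laws through
`SourceBracketCombOfS3c.hasSum_unitS_SpureRecAt_zero`; member `j+1`: §3 ∕ §4) — the hypothesis `h3` of `SourceBracketCombOfS3c` §2–§4, with level-dependent units. -/
theorem hasSum_unitS_SpureRecAt_of_threeFace (hLc : 1 ≤ Lc) {r : Fin (d + 1) → ℕ} (hr : r ∈ box (d + 1) Lc) (cE cVH cΛ : ℝ)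
    (h3F : ∀ (j : ℕ) (γ α β : Fin (d + 1)),
      ∑ v ∈ box (d + 1) Lc, (if toSite v γ % (Lc : ℤ) = (Lc : ℤ) - 1 then (1 : ℝ) else 0) *
          ∑' yw : Site (d + 1) × Site (d + 1),
            (if yw.1 α % (Lc : ℤ) = (Lc : ℤ) - 1 then (1 : ℝ) else 0) * (if yw.2 β % (Lc : ℤ) = (Lc : ℤ) - 1 then (1 : ℝ) else 0) *
              SrecAt d Lc (toSite r) cE cVH cΛ j γ (toSite v) yw.1 yw.2 (Sum.inl α) (Sum.inl β) = 0)
    (j : ℕ) (sf sm : ℝ) (κ a b : Fin (d + 1)) (s : Site (d + 1)) :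
    HasSum (fun p : Site (d + 1) × Site (d + 1) =>
        unitS sf sm (SpureRecAt d Lc (toSite r) cE cVH cΛ j) κ s p.1 p.2 (Sum.inl a) (Sum.inl b)) 0 ∧
      HasSum (fun p : Site (d + 1) × Site (d + 1) =>
        unitS sf sm (SpureRecAt d Lc (toSite r) cE cVH cΛ j) κ p.1 p.2 s (Sum.inl a) (Sum.inl b)) 0 ∧
      HasSum (fun p : Site (d + 1) × Site (d + 1) =>
        unitS sf sm (SpureRecAt d Lc (toSite r) cE cVH cΛ j) κ p.1 s p.2 (Sum.inl a) (Sum.inl b)) 0 := by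
  cases j with
  | zero => exact SourceBracketCombOfS3c.hasSum_unitS_SpureRecAt_zero (toSite r) sf sm cE cVH cΛ κ a b s
  | succ j =>
    have h1 := hasSum_legs_unitS_SpureRecAt_succ hLc hr sf sm cE cVH cΛ j κ s a b
    have h2 := hasSum_slot_leg_unitS_SpureRecAt_succ hLc hr sf sm cE cVH cΛ j κ a b s
    have h3 := hasSum_slot_leg'_unitS_SpureRecAt_succ hLc hr sf sm cE cVH cΛ j κ a b s
    rw [h3F j κ a b, mul_zero] at h1 h2 h3
    exact ⟨h1, h2, h3⟩

end Package

section Literal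

variable {Lc : ℕ} [NeZero Lc] {r : Fin (3 + 1) → ℕ}

/-- NOT IN PRINT; OUR PROOF ATTEMPT ([folklore] this lineage's `SourceBracketCombOfS3c.exists_allScalesSeq_JsRowD1Pin_of_S3c_C_QD` with `h3 := hasSum_unitS_SpureRecAt_of_threeFace`).
**ROAD FP's D1 LITERAL OF RECORD MODULO «3F-REC» ∧ (C) ∧ (Q-D) ∧ (Q-D-rate)** (`Lc` odd, `Lc ≥ 2`, colour `N`; data pinned by equations exactly as in leaf-01's
capstone): the W-slot binder list of the literal reads, BY ONE TREE NAME, {«3F-REC» (= `h3F`: at every level the three-face-legs cell form of the FOLDED table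
`SrecAt … j` vanishes — ONE cell identity per level, slot direction and field pair), (C)sym, (Q-D), (Q-D-rate)}.  CONDITIONAL on the four rows; NOT «D1 closed»;
NEVER «G-an2-4 closed» as (CONV-C); NOT D1, NOT `BetaPertH`, NOT continuum, NOT Clay. -/
theorem exists_allScalesSeq_JsRowD1Pin_of_threeFace_C_QD (hodd : Odd Lc) (hLc : 2 ≤ Lc) (N : ℕ) {cE cVH cΛ cE₂ cB : ℝ}
    {Tc : Fin 4 → Fin 4 → Fin 4 → Fin 4 → ℝ} {vh₂S : Tab 3}
    (hρ : r = ctrOff (3 + 1) Lc) (hcE : cE = (Lc : ℝ) ^ 4) (hcVH : cVH = -((Lc : ℝ) ^ 8 / 2)) (hcΛ : cΛ = 2 / (Lc : ℝ) ^ 4) (hcE₂ : cE₂ = (Lc : ℝ) ^ 8)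
    (hcB : cB = -((Lc : ℝ) ^ 12 / 4)) (hTc : Tc = (8 * (N : ℝ) ^ 2)⁻¹ • wsym22 N) (hvh : vh₂S = vh₂SAn1 Lc)
    (h3F : ∀ (j : ℕ) (γ α β : Fin (3 + 1)),
      ∑ v ∈ box (3 + 1) Lc, (if toSite v γ % (Lc : ℤ) = (Lc : ℤ) - 1 then (1 : ℝ) else 0) *
          ∑' yw : Site (3 + 1) × Site (3 + 1),
            (if yw.1 α % (Lc : ℤ) = (Lc : ℤ) - 1 then (1 : ℝ) else 0) * (if yw.2 β % (Lc : ℤ) = (Lc : ℤ) - 1 then (1 : ℝ) else 0) *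
              SrecAt 3 Lc (toSite r) cE cVH cΛ j γ (toSite v) yw.1 yw.2 (Sum.inl α) (Sum.inl β) = 0)
    {CY δY CY' θY δY' : ℝ}
    (hC : ∀ (i : ℕ) (κ κ' κ₁ κ₂ : Fin (3 + 1)),
      zmode Lc (unitS₂ (sfStep Lc i) (smStep 3 Lc i) (T2RecAt 3 Lc (toSite r) cE cVH cΛ cE₂ cB Tc vh₂S (mixFFAt (toSite r) Lc) i)) κ κ' (Sum.inl κ₁) (Sum.inl κ₂)
          + zmode Lc (unitS₂ (sfStep Lc i) (smStep 3 Lc i) (T2RecAt 3 Lc (toSite r) cE cVH cΛ cE₂ cB Tc vh₂S (mixFFAt (toSite r) Lc) i)) κ' κ (Sum.inl κ₁) (Sum.inl κ₂)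
        = zmode Lc (unitS₂ (sfStep Lc i) (smStep 3 Lc i) (T2RecOf 3 Lc (fun j => KInvStep (d := 3) Lc j) (SpureRecAt 3 Lc (toSite r) cE cVH cΛ) (M1At 3 Lc (toSite r) cΛ) cE₂ cB Tc vh₂S (mixFFAt (toSite r) Lc) i)) κ κ' (Sum.inl κ₁) (Sum.inl κ₂)
          + zmode Lc (unitS₂ (sfStep Lc i) (smStep 3 Lc i) (T2RecOf 3 Lc (fun j => KInvStep (d := 3) Lc j) (SpureRecAt 3 Lc (toSite r) cE cVH cΛ) (M1At 3 Lc (toSite r) cΛ) cE₂ cB Tc vh₂S (mixFFAt (toSite r) Lc) i)) κ' κ (Sum.inl κ₁) (Sum.inl κ₂))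
    (hY : ∀ m : ℕ, LocStencil₂ ((fun κ u κ' u' => dressKBmAt (toSite r) Lc (coProjBmAtK (toSite r) Lc (fun κ₁ u₁ => coProjBmAtK (toSite r) Lc
            ((unitS₂ (sfStep Lc m) (smStep 3 Lc m) (T2RecAt 3 Lc (toSite r) cE cVH cΛ cE₂ cB Tc vh₂S (mixFFAt (toSite r) Lc) m)) κ₁ u₁) κ' u') κ u)) -
          (unitS₂ (sfStep Lc m) (smStep 3 Lc m) (T2RecAt 3 Lc (toSite r) cE cVH cΛ cE₂ cB Tc vh₂S (mixFFAt (toSite r) Lc) m))) CY δY) (hδY : 0 < δY)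
    (hYr : ∀ m : ℕ, LocStencil₂ (((fun κ u κ' u' => dressKBmAt (toSite r) Lc (coProjBmAtK (toSite r) Lc (fun κ₁ u₁ => coProjBmAtK (toSite r) Lc
            ((unitS₂ (sfStep Lc (m + 1)) (smStep 3 Lc (m + 1)) (T2RecAt 3 Lc (toSite r) cE cVH cΛ cE₂ cB Tc vh₂S (mixFFAt (toSite r) Lc) (m + 1))) κ₁ u₁) κ' u') κ u)) -
          (unitS₂ (sfStep Lc (m + 1)) (smStep 3 Lc (m + 1)) (T2RecAt 3 Lc (toSite r) cE cVH cΛ cE₂ cB Tc vh₂S (mixFFAt (toSite r) Lc) (m + 1)))) -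
      ((fun κ u κ' u' => dressKBmAt (toSite r) Lc (coProjBmAtK (toSite r) Lc (fun κ₁ u₁ => coProjBmAtK (toSite r) Lc
            ((unitS₂ (sfStep Lc m) (smStep 3 Lc m) (T2RecAt 3 Lc (toSite r) cE cVH cΛ cE₂ cB Tc vh₂S (mixFFAt (toSite r) Lc) m)) κ₁ u₁) κ' u') κ u)) -
          (unitS₂ (sfStep Lc m) (smStep 3 Lc m) (T2RecAt 3 Lc (toSite r) cE cVH cΛ cE₂ cB Tc vh₂S (mixFFAt (toSite r) Lc) m)))) (CY' * θY ^ m) δY') (hθY0 : 0 ≤ θY) (hθY1 : θY < 1) (hδY' : 0 < δY') (μ ν : Fin 4) :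
    ∃ κ θ : ℝ, 0 ≤ θ ∧ θ < 1 ∧ AllScalesSeq (fun j => B12Beta.secondMoment (TbalOf Lc (JsRowD1Pin hodd N) j) μ ν) κ θ := by
  have hLc1 : 1 ≤ Lc := le_trans (by norm_num) hLc
  have hr : r ∈ box (3 + 1) Lc := by rw [hρ]; exact ctrOff_mem_box (by omega)
  exact SourceBracketCombOfS3c.exists_allScalesSeq_JsRowD1Pin_of_S3c_C_QD hodd hLc N hρ hcE hcVH hcΛ hcE₂ hcB hTc hvh
    (fun i κ a b s => hasSum_unitS_SpureRecAt_of_threeFace hLc1 hr cE cVH cΛ h3F i (sfStep Lc i) (smStep 3 Lc i) κ a b s)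
    hC hY hδY hYr hθY0 hθY1 hδY' μ ν

end Literal

end Summit.QuantumFields.BalabanUV.Beta.GAN24.SpureRecLegChargeThreeFace

end
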